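import Summits.QuantumFields.YangMills.Theses.ColdBoxAllGroups
import Summits.QuantumFields.YangMills.Theorems.ColdBoxAllGroupsExpChartPackage2AB
import Summits.QuantumFields.YangMills.Theorems.ColdBoxAllGroupsExpChartPackage2Haar
import HarnessLib

/-!
# `stub_expChartPackage2` — the second-order exponential chart package (item stmt-QuantumFields-22893)

Route `ColdBoxAllGroups` of `QuantumFields/YangMills`, support item stmt-QuantumFields-22893
`Summit.QuantumFields.YangMills.Theses.ColdBoxAllGroups.ExpChartPackage2` = the shared stub D2
`stub_expChartPackage2` of the birth skeleton of crux `BoxFloorAllGroups` (stmt-QuantumFields-22254,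
`Cruxes/BoxFloorAllGroups/Lines/birth.lean`).

For every compact group `G` with a faithful continuous unitary representation `ρ : G →* M_N(ℂ)` the tree's
exponential chart `ψ = expChart ρ : ℝ^D → G` (`ρ (ψ a) = exp (lieIso ρ a)`, `D = dimE ρ = dim 𝔤_ρ`) satisfies,
for some `r₂, C₂, c_H > 0`:
(a) `|N − Re tr ρ(ψ a) − ‖a‖²/2| ≤ C₂ ‖a‖⁴` on `‖a‖ ≤ r₂` (`ExpChart2.abs_quadCost_expChart_sub_le`);
(b) for `‖a‖, ‖b‖ ≤ r₂` some `c` with `ψ a ψ b = ψ c`, `‖c‖ ≤ 2(‖a‖ + ‖b‖)`,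
    `‖lieIso c − (lieIso a + lieIso b + ½[lieIso a, lieIso b])‖_F ≤ C₂ (‖a‖ + ‖b‖)³` (`ExpChart2.exists_bch_expChart`);
(c) a continuous `J` with `|J a − 1| ≤ C₂‖a‖²` on `‖a‖ ≤ r₂` and
    `∫_{ψ(B̄(0,s))} F dσ = c_H ∫_{B̄(0,s)} F(ψ a) J(a) da` for `0 < s ≤ r₂`, `F ≥ 0` measurable
    (`ExpChart2.exists_haar_expChart_eq`, Helgason's Theorem 1.14 in the route's chart coordinates).

This file only assembles the three landed parts into the item's statement BY NAME.  No claim about the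
Yang–Mills mass gap is made (support lemma of a RECORD-label rung R2xi-G line).

References: S. Chatterjee, arXiv:1602.01222 §11; M. Sepanski, *Compact Lie Groups* (2007) Thm. 4.6, §1.3;
S. Helgason (2000) Ch. I Thm. 1.14; T. Bałaban, CMP 98 (1985) (30).
-/

noncomputable section

open scoped ENNReal
open MeasureTheory
open Literature.MathematicalPhysics.QuantumFieldTheory

namespace Summit.QuantumFields.YangMills.Theorems.ColdBoxAllGroups

open Summit.QuantumFields.YangMills.Theorems.FreeEnergyLogCoefficient (dimE lieIso expChart)

/-- **Stub D2 `stub_expChartPackage2` of crux `BoxFloorAllGroups` = support item stmt-QuantumFields-22893: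
the second-order exponential chart package** — quadratic cost to `O(|a|⁴)`, BCH to second order with cubic
remainder, Haar `= c_H · J · Lebesgue` on chart balls with `|J − 1| ≤ C₂|a|²` — for every compact group
faithfully and unitarily represented in `M_N(ℂ)`. [cite: Sepanski2007, Thm. 4.6] [cite: arXiv160201222, §11] -/
theorem stub_expChartPackage2 : Summit.QuantumFields.YangMills.Theses.ColdBoxAllGroups.ExpChartPackage2 := by
  intro N G _ _ _ _ _ _ ρ hρ hinj hU
  -- (b) BCH
  obtain ⟨rb, hrb, hrb10, hbch⟩ := ExpChart2.exists_bch_expChart ρ hρ hinj hU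
  -- (c) Haar, through the lattice representation `⟨N, ρ⟩`
  obtain ⟨rc, Cc, cH, hrc, hCc, hcH, J, hJc, hJb, hint⟩ :=
    ExpChart2.exists_haar_expChart_eq (G := G) ⟨N, ρ, hρ, hinj, hU⟩
  refine ⟨min rb rc, max ((N : ℝ) / 8) (max 5 Cc), cH, lt_min hrb hrc,
    lt_max_of_lt_right (lt_max_of_lt_left (by norm_num)), hcH, fun a ha => ?_, fun a b ha hb => ?_,
    J, hJc, fun a ha => ?_, fun s hs hsr F hF => ?_⟩
  · -- (a)
    have ha1 : ‖a‖ ≤ 1 := ha.trans ((min_le_left _ _).trans (hrb10.trans (by norm_num)))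
    refine (ExpChart2.abs_quadCost_expChart_sub_le ρ hρ a ha1).trans ?_
    exact mul_le_mul_of_nonneg_right (le_max_left _ _) (by positivity)
  · -- (b)
    obtain ⟨c, hc, hcn, hcb⟩ := hbch a b (ha.trans (min_le_left _ _)) (hb.trans (min_le_left _ _))
    refine ⟨c, hc, hcn, hcb.trans ?_⟩
    exact mul_le_mul_of_nonneg_right ((le_max_left _ _).trans (le_max_right _ _)) (by positivity)
  · -- (c), Jacobian bound
    refine (hJb a (ha.trans (min_le_right _ _))).trans ?_
    exact mul_le_mul_of_nonneg_right ((le_max_right _ _).trans (le_max_right _ _)) (by positivity)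
  · -- (c), the integral identity
    exact hint s hs (hsr.trans (min_le_right _ _)) F hF

end Summit.QuantumFields.YangMills.Theorems.ColdBoxAllGroups

end
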